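import Summits.QuantumAdvantage.QuantumAdvantage.Theorems.WildDialDollC

/-! # WildDialDoll — part 4/4 (mechanical split for landing of `WildDialDoll`; content verbatim; scopes re-opened with their variables) -/

set_option linter.dupNamespace false

namespace Summit.QuantumAdvantage.QuantumAdvantage.Theorems.WildDialDoll
open Finset
open Summit.QuantumAdvantage.AdviceFreeQNC0
open Summit.QuantumAdvantage.AdviceFreeQNC0.Fib19
open Literature.Computability.QuantumComplexity
open Literature.Computability.QuantumComplexity.RingHLF
open Literature.Computability.MetaComplexity

section Family

/-- **THE BRIDGE**: the doll points of the family, read as words, are the family words. -/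
theorem getD_famWord (N d z : ℕ) (_hN : 12 * d + 6 ≤ N) (hz1 : 1 ≤ z) (hz : z ≤ 3) (S : Finset (Fin (2 * d + 1)))
    (i : Fin N) : dollPt (famX N z) (famT N d) S i = (famWord N d z S).getD i.val true := by
  have hsb := shellBits_ne_nil (2 * d + 1) (by omega) S
  have hlen := length_nest _ hsb
  rw [length_shellBits] at hlen
  unfold dollPt flipAt famX
  simp only [famWord]
  by_cases h4 : i.val < 4
  · rw [List.getD_append _ _ _ _ (by simp [B0]; omega)]
    have hmem : ¬ (i ∈ S.biUnion (famT N d)) := by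
      rw [mem_biUnion_famT_iff]; rintro ⟨j, hj, _, h⟩; omega
    simp only [hmem, decide_false, Bool.xor_false]
    have : i.val = 0 ∨ i.val = 1 ∨ i.val = 2 ∨ i.val = 3 := by omega
    rcases this with h | h | h | h <;> simp [B0, h]
  · rw [List.getD_append_right _ _ _ _ (by simp [B0]; omega), show (B0 z).length = 4 by rfl]
    have hxz : decide (i.val ≠ z) = true := by simp; omega
    rw [hxz, Bool.true_xor]
    by_cases h2 : i.val - 4 < (nest (shellBits (2 * d + 1) S)).length
    · rw [List.getD_append _ _ _ _ h2]
      rw [hlen] at h2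
      -- both sides are `false` iff `i` is a flipped pair position
      have key := nest_getD_eq_false_iff (shellBits (2 * d + 1) S) (i.val - 4) hsb
      rw [length_shellBits] at key
      have hiff : (nest (shellBits (2 * d + 1) S)).getD (i.val - 4) true = false ↔ i ∈ S.biUnion (famT N d) := by
        rw [key, mem_biUnion_famT_iff]
        clear key
        constructor
        · rintro ⟨j, hj, hcj, ht⟩
          refine ⟨j, hj, (shellBits_getD_eq_false_iff _ _ _ hj).1 hcj, ?_⟩
          rcases ht with ht | ht
          · left; omega
          · right; omega
        · rintro ⟨j, hj, hjS, h⟩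
          refine ⟨j, hj, (shellBits_getD_eq_false_iff _ _ _ hj).2 hjS, ?_⟩
          rcases h with h | h
          · left; omega
          · right; omega
      generalize (nest (shellBits (2 * d + 1) S)).getD (i.val - 4) true = b at hiff ⊢
      cases b
      · have hP := hiff.1 rfl
        simp [hP]
      · have hP : ¬ (i ∈ S.biUnion (famT N d)) := fun hP => Bool.noConfusion (hiff.2 hP)
        simp [hP]
    · rw [List.getD_append_right _ _ _ _ (by omega), getD_replicate_true]
      have hne : ¬ (i ∈ S.biUnion (famT N d)) := by
        rw [mem_biUnion_famT_iff]; rintro ⟨j, hj, _, h⟩; omega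
      simp [hne]

/-- WildDial doll helper `ofFn_dollPt_fam` (lens-1 g5 WildDialDoll; see the enclosing section docstring). -/
theorem ofFn_dollPt_fam (N d z : ℕ) (hN : 12 * d + 6 ≤ N) (hz1 : 1 ≤ z) (hz : z ≤ 3) (S : Finset (Fin (2 * d + 1))) :
    List.ofFn (dollPt (famX N z) (famT N d) S) = famWord N d z S := by
  apply List.ext_getElem
  · rw [List.length_ofFn, length_famWord N d z hN]
  · intro i h1 h2
    rw [List.getElem_ofFn, getD_famWord N d z hN hz1 hz S, List.getD_eq_getElem _ _ h2]

/-! ### parity and signed count of the family word -/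

/-- WildDial doll helper `reflBit_shellBits` (lens-1 g5 WildDialDoll; see the enclosing section docstring). -/
theorem reflBit_shellBits (m : ℕ) (S : Finset (Fin m)) : reflBit (shellBits m S) = decide (Odd S.card) := by
  have h := reflBit_ofFn_iff (fun j : Fin m => !decide (j ∈ S))
  have hS : (univ.filter fun j : Fin m => (!decide (j ∈ S)) = false) = S := by ext j; simp
  rw [hS] at h
  unfold shellBits
  by_cases ho : Odd S.card
  · simp only [ho, decide_true]; exact h.2 ho
  · simp only [ho, decide_false]; exact Bool.eq_false_iff.2 fun h' => ho (h.1 h')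

/-- WildDial doll helper `reflBit_famWord` (lens-1 g5 WildDialDoll; see the enclosing section docstring). -/
theorem reflBit_famWord (N d z : ℕ) (S : Finset (Fin (2 * d + 1))) : reflBit (famWord N d z S) = reflBit (B0 z) := by
  simp only [famWord, reflBit_append, reflBit_nest, reflBit_replicate_true, Bool.xor_false]

/-- WildDial doll helper `sigmaSum_famWord` (lens-1 g5 WildDialDoll; see the enclosing section docstring). -/
theorem sigmaSum_famWord (N d z : ℕ) (S : Finset (Fin (2 * d + 1))) :
    sigmaSum (famWord N d z S) = ((N - (12 * d + 6) : ℕ) : ZMod 3) + (if Odd S.card then 0 else 2) + sigmaSum (B0 z) := by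
  have hsb := shellBits_ne_nil (2 * d + 1) (by omega) S
  simp only [famWord, sigmaSum_append, reflBit_append, reflBit_nest, reflBit_replicate_true, sigmaSum_replicate_true,
    sigmaSum_nest _ hsb, reflBit_shellBits, Bool.xor_false]
  by_cases ho : Odd S.card <;> simp [ho]

/-- The residue the family is tuned to: `N − 12d − 6 + σ(B0(famZ N)) ≡ 2 (mod 3)`, and `B0 (famZ N)` has one zero. -/
theorem famZ_spec (N d : ℕ) (hN : 12 * d + 6 ≤ N) :
    1 ≤ famZ N ∧ famZ N ≤ 3 ∧ reflBit (B0 (famZ N)) = true ∧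
      ((N - (12 * d + 6) : ℕ) : ZMod 3) + sigmaSum (B0 (famZ N)) = 2 := by
  have hmod : ((N - (12 * d + 6) : ℕ) : ZMod 3) = ((N % 3 : ℕ) : ZMod 3) := by
    rw [← ZMod.natCast_mod (N - (12 * d + 6)) 3]; congr 1; omega
  rw [hmod]
  obtain ⟨r, hr, hNr⟩ : ∃ r, r < 3 ∧ N % 3 = r := ⟨N % 3, Nat.mod_lt _ (by norm_num), rfl⟩
  have h2 : (2 * N + 1) % 3 = (2 * r + 1) % 3 := by omega
  rw [hNr]
  unfold famZ; rw [h2]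
  interval_cases r <;> simp [B0, reflBit, sigmaSum] <;> decide



/-! ### the alternating parity sum and the final assembly -/

/-- `Σ_{S ⊆ [m]} (−1)^{|S|} · g(|S| mod 2) = 2^{m−1} (g(even) − g(odd)) ≠ 0` in `ℤ/3` when the two values differ (`m ≥ 1`):
pair `S` with `S △ {0}`. -/
theorem paritySum_ne_zero (m : ℕ) (hm : 1 ≤ m) (A B : ZMod 3) (hAB : A ≠ B) :
    ∑ S : Finset (Fin m), (-1 : ZMod 3) ^ S.card * (if Odd S.card then B else A) ≠ 0 := by
  set i0 : Fin m := ⟨0, hm⟩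
  set f : Finset (Fin m) → ZMod 3 := fun S => (-1 : ZMod 3) ^ S.card * (if Odd S.card then B else A)
  have hi0 : i0 ∉ (univ : Finset (Fin m)).erase i0 := by simp
  have huniv : (univ : Finset (Finset (Fin m))) = (insert i0 (univ.erase i0)).powerset := by
    rw [Finset.insert_erase (Finset.mem_univ _), Finset.powerset_univ]
  show ∑ S ∈ (univ : Finset (Finset (Fin m))), f S ≠ 0
  rw [huniv, Finset.sum_powerset_insert hi0, ← Finset.sum_add_distrib]
  have hpair : ∀ T ∈ ((univ : Finset (Fin m)).erase i0).powerset, f T + f (insert i0 T) = A - B := by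
    intro T hT
    have hiT : i0 ∉ T := fun h => hi0 (Finset.mem_powerset.1 hT h)
    simp only [f, Finset.card_insert_of_notMem hiT]
    rcases Nat.even_or_odd T.card with he | ho
    · have ho' : Odd (T.card + 1) := he.add_one
      rw [if_neg (Nat.not_odd_iff_even.2 he), if_pos ho', he.neg_one_pow, ho'.neg_one_pow]; ring
    · have he' : Even (T.card + 1) := ho.add_one
      rw [if_pos ho, if_neg (Nat.not_odd_iff_even.2 he'), ho.neg_one_pow, he'.neg_one_pow]; ring
  rw [Finset.sum_congr rfl hpair, Finset.sum_const, Finset.card_powerset, Finset.card_erase_of_mem (Finset.mem_univ _),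
    Finset.card_univ, Fintype.card_fin, nsmul_eq_mul]
  push_cast
  exact mul_ne_zero (pow_ne_zero _ (by decide)) (sub_ne_zero.2 hAB)

/-- WildDial doll helper `getD_famWord_zero` (lens-1 g5 WildDialDoll; see the enclosing section docstring). -/
theorem getD_famWord_zero (N d z : ℕ) (S : Finset (Fin (2 * d + 1))) : (famWord N d z S).getD 0 true = decide (0 ≠ z) := by
  rw [famWord, List.getD_append _ _ _ _ (by simp [B0])]; simp [B0]

/-- WildDial doll helper `getD_famWord_one` (lens-1 g5 WildDialDoll; see the enclosing section docstring). -/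
theorem getD_famWord_one (N d z : ℕ) (S : Finset (Fin (2 * d + 1))) : (famWord N d z S).getD 1 true = decide (1 ≠ z) := by
  rw [famWord, List.getD_append _ _ _ _ (by simp [B0])]; simp [B0]

/-- **THE UNIFORM DOLL FAMILY IS A WITNESS, for every `d` and every `N ≥ 12d + 6`.** -/
theorem familyWitness (d N : ℕ) (hN : 12 * d + 6 ≤ N) : DollWitness N d (famX N (famZ N)) (famT N d) := by
  obtain ⟨hz1, hz3, hB0, hkey⟩ := famZ_spec N d hN
  have h3 : 3 ≤ N := by omega
  have hword : ∀ S, List.ofFn (dollPt (famX N (famZ N)) (famT N d) S) = famWord N d (famZ N) S :=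
    fun S => ofFn_dollPt_fam N d (famZ N) hN hz1 hz3 S
  have hσ : ∀ S : Finset (Fin (2 * d + 1)),
      sigmaSum (List.ofFn (dollPt (famX N (famZ N)) (famT N d) S)) = (if Odd S.card then 0 else 2) + 2 := by
    intro S; rw [hword, sigmaSum_famWord, ← hkey]; ring
  have hy0 : ∀ S, dollPt (famX N (famZ N)) (famT N d) S ⟨0, by omega⟩ = true := by
    intro S; rw [getD_famWord N d _ hN hz1 hz3 S]
    show (famWord N d (famZ N) S).getD 0 true = true
    rw [getD_famWord_zero]; simp; omega
  have hy1 : ∀ S, dollPt (famX N (famZ N)) (famT N d) S ⟨1, by omega⟩ = decide (1 ≠ famZ N) := by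
    intro S; rw [getD_famWord N d _ hN hz1 hz3 S]
    exact getD_famWord_one N d (famZ N) S
  refine ⟨h3, ?_, ?_, ?_⟩
  · intro k l hkl
    have hkl' : k.val ≠ l.val := fun h => hkl (Fin.ext h)
    simp only [famT, Finset.disjoint_filter]
    intro i _ h1 h2
    have hk := k.isLt; have hl := l.isLt
    rcases h1 with h1 | h1 <;> rcases h2 with h2 | h2 <;> omega
  · intro S
    refine ⟨?_, ?_⟩
    · show reflBit (List.ofFn _) = true
      rw [hword, reflBit_famWord]; exact hB0
    · show kernelVec _ (fixVec (sigmaSum (List.ofFn _))) ⟨0, _⟩ = true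
      rw [(kernelLine_zero_one h3 _).1, hσ S]
      by_cases ho : Odd S.card
      · rw [if_pos ho]; decide
      · rw [if_neg ho]; decide
  · have hnxt : nxt (⟨0, by omega⟩ : Fin N) = ⟨1, by omega⟩ := Fin.ext (show (0 + 1) % N = 1 from Nat.mod_eq_of_lt (by omega))
    have hob : ∀ S : Finset (Fin (2 * d + 1)), oracleBit ⟨0, by omega⟩ (dollPt (famX N (famZ N)) (famT N d) S)
        = (if Odd S.card then !decide (1 ≠ famZ N) else decide (1 ≠ famZ N)) := by
      intro S
      unfold oracleBit tGuess
      rw [hnxt, hy0 S, hy1 S]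
      unfold kline
      rw [(kernelLine_zero_one h3 _).2, hy0 S, hσ S]
      by_cases ho : Odd S.card
      · rw [if_pos ho, if_pos ho]; cases decide (1 ≠ famZ N) <;> decide
      · rw [if_neg ho, if_neg ho]; cases decide (1 ≠ famZ N) <;> decide
    simp_rw [hob]
    generalize decide (1 ≠ famZ N) = b
    have hform : ∀ S : Finset (Fin (2 * d + 1)),
        (if (if Odd S.card then !b else b) = true then (0 : ZMod 3) else 1)
          = (if Odd S.card then (if (!b) = true then (0 : ZMod 3) else 1) else (if b = true then (0 : ZMod 3) else 1)) := by
      intro S; by_cases ho : Odd S.card <;> simp [ho]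
    simp_rw [hform]
    apply paritySum_ne_zero (2 * d + 1) (by omega)
    cases b <;> decide


/-- `FamilyWitness` holds. [PROVED] -/
theorem familyWitness_holds : FamilyWitness := fun d N hN => familyWitness d N hN

/-- **THEOREM `canonCoin3` (all degrees, all large `n`).**  For every `d` and every `n ≥ 12d + 6`, NO degree-`≤ d` polynomial event over `𝔽₃`
completes the canonical base `t ⊕ e_1` at pin `0`: the coin indicator of the hard class has UNBOUNDED `𝔽₃`-degree.  Equivalently
(`canonCoinAt_iff_sig`): no constant-degree level set separates the monodromy residues `σ = 1` from `σ = 2` on the odd class (up to the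
twist `x₁`).  This SETTLES the attack leaf `CanonCoin3` of the node. [PROVED — `familyWitness` + `canonCoinAt_of_dollWitness`] -/
theorem canonCoin3 : CanonCoin3 := canonCoin3_of_familyWitness familyWitness_holds

/-- Effective form: `CanonCoinAt n d` for all `n ≥ 12d + 6`. [PROVED] -/
theorem canonCoinAt_of_le {n d : ℕ} (hn : 12 * d + 6 ≤ n) : CanonCoinAt n d :=
  canonCoinAt_of_dollWitness (familyWitness d n hn)

end Family

/-! ### §4d THE RESIDUE LAW — the coin event in the tree's monodromy coordinates (all `n`; PROVED)

`σ(x) := sigmaSum (List.ofFn x) ∈ ℤ/3` is the tree's signed count `Σ_i (−1)^{#zeros after i}` (`RingKernel`), and the kernel line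
starts with the fixed state `fixVec σ` (`RingFlipMap.kernelLine_zero_one`).  Consequence: at pin `0` the coin event is a RESIDUE event of
`σ`, twisted by the single coordinate `x₁` — the canonical coin game is «separate `σ = 1` from `σ = 2` by a level set of a degree-`d`
polynomial over `𝔽₃`, up to the twist `x₁`, ignoring `σ = 0`».  In the `±1` variables `s_i := (−1)^{#zeros after i}` the statistic
`σ = Σ_i s_i` is LINEAR over `𝔽₃` (one modulus only!) while `x_j = [s_{j−1} = s_j]`: the whole difficulty of `CanonCoin3` is the change of
variables `x ↔ s` — a degree-`d` polynomial in `x` sees only `s`-monomials of total adjacent-transposition length `≤ d`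
(NODE-g5.md §3b: the METRIC-DEGREE reformulation and the blocking plan for all `d`). -/

/-- The tree's signed count of the word of `x`. -/
abbrev sig {n : ℕ} (x : Fin n → Bool) : ZMod 3 := sigmaSum (List.ofFn x)

/-- WildDial doll helper `kline_zero_eq_fixVec` (lens-1 g5 WildDialDoll; see the enclosing section docstring). -/
theorem kline_zero_eq_fixVec {n : ℕ} (hn : 3 ≤ n) (x : Fin n → Bool) : kline x ⟨0, by omega⟩ = (fixVec (sig x)).2 :=
  (kernelLine_zero_one hn x).1

/-- WildDial doll helper `kline_one_eq_fixVec` (lens-1 g5 WildDialDoll; see the enclosing section docstring). -/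
theorem kline_one_eq_fixVec {n : ℕ} (hn : 3 ≤ n) (x : Fin n → Bool) :
    kline x ⟨1, by omega⟩ = xor (fixVec (sig x)).1 (x ⟨0, by omega⟩ && (fixVec (sig x)).2) :=
  (kernelLine_zero_one hn x).2

/-- **RESIDUE LAW** (all `n ≥ 3`). On the odd class the canonical strategy with wild bit `w` at pin `0` wins iff
`σ(x) = 0`, or `σ(x) = 1 ∧ w(x) = x₁`, or `σ(x) = 2 ∧ w(x) = ¬x₁`. [PROVED; from `rel_canonStrat_iff` + `kernelLine_zero_one`] -/
theorem rel_canonStrat_zero_iff_sig {n : ℕ} (hn : 3 ≤ n) (w : (Fin n → Bool) → Bool) (x : Fin n → Bool) (hodd : IsOdd x) :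
    RingHLF.Rel x (canonStrat ⟨0, by omega⟩ w x) ↔
      (sig x = 0 ∨ (sig x = 1 ∧ w x = x ⟨1, by omega⟩) ∨ (sig x = 2 ∧ w x = !x ⟨1, by omega⟩)) := by
  rw [rel_canonStrat_iff hn _ w x hodd]
  have hnxt : nxt (⟨0, by omega⟩ : Fin n) = ⟨1, by omega⟩ := nxt_of_succ rfl (by omega)
  have ht : tGuess x ⟨0, by omega⟩ = xor (x ⟨0, by omega⟩) (x ⟨1, by omega⟩) := by
    unfold tGuess; rw [hnxt]
  rw [hnxt, kline_zero_eq_fixVec hn x, kline_one_eq_fixVec hn x, ht]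
  generalize sig x = s; generalize w x = b; generalize x ⟨0, by omega⟩ = x0; generalize x ⟨1, by omega⟩ = x1
  revert s b x0 x1; decide

/-- **The perfect wild bit in residue form**: on `σ ≠ 0` the wild bit MUST equal `x₁ ⊕ [σ = 2]`; on `σ = 0` it is free. [PROVED] -/
theorem not_rel_canonStrat_zero_iff_sig {n : ℕ} (hn : 3 ≤ n) (w : (Fin n → Bool) → Bool) (x : Fin n → Bool) (hodd : IsOdd x) :
    ¬ RingHLF.Rel x (canonStrat ⟨0, by omega⟩ w x) ↔
      (sig x ≠ 0 ∧ w x ≠ xor (x ⟨1, by omega⟩) (decide (sig x = 2))) := by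
  rw [rel_canonStrat_zero_iff_sig hn w x hodd]
  generalize sig x = s; generalize w x = b; generalize x ⟨1, by omega⟩ = x1
  revert s b x1; decide

/-- **THE COIN GAME IN RESIDUE FORM** (all `n`): `CanonCoinAt n d` iff NO degree-`d` polynomial `P₀` over `𝔽₃` has
`[P₀(x) = 1] = x₁ ⊕ [σ(x) = 2]` at every odd `x` with `σ(x) ≠ 0`. [PROVED] -/
theorem canonCoinAt_iff_sig (n d : ℕ) : CanonCoinAt n d ↔
    ∀ h3 : 3 ≤ n, ∀ P₀ : Smolensky.CubeFn (ZMod 3) n, P₀ ∈ Smolensky.lowDeg (ZMod 3) n d →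
      ∃ x : Fin n → Bool, OddZeros x ∧ sig x ≠ 0 ∧
        decide (P₀ x = 1) ≠ xor (x ⟨1, by omega⟩) (decide (sig x = 2)) := by
  unfold CanonCoinAt
  refine forall_congr' fun h3 => forall_congr' fun P₀ => forall_congr' fun _ => exists_congr fun x => ?_
  constructor
  · rintro ⟨hx, hnr⟩
    exact ⟨hx, (not_rel_canonStrat_zero_iff_sig h3 _ x ((isOdd_iff_oddZeros x).2 hx)).1 hnr⟩
  · rintro ⟨hx, hs, hw⟩
    exact ⟨hx, (not_rel_canonStrat_zero_iff_sig h3 _ x ((isOdd_iff_oddZeros x).2 hx)).2 ⟨hs, hw⟩⟩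

end Summit.QuantumAdvantage.QuantumAdvantage.Theorems.WildDialDoll
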